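import Summits.ValiantsHypothesis.ValiantsHypothesis.Theorems.MonotoneRestorationMonotoneRestorationQPZetaEntrySymmetric
import Literature.Computability.AlgebraicComplexity.BlaserJindalSymmetricProofs
import HarnessLib

/-! # Route MonotoneRestoration — crux `MonotoneRestorationQP` (stmt-ValiantsHypothesis-15886):
# THEOREM ζ-E is now UNCONDITIONAL

`Theorems/MonotoneRestorationMonotoneRestorationQPZetaEntrySymmetric.lean` proves THEOREM ζ-E of line
Sketch v10 — the reflection-group regime restores: `VP` families symmetric in ALL `n²` matrix entries
have square-symmetric circuits of quasi-polynomial size — CONDITIONALLY on the named fact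
`BlaserJindal2019_thm4` (Bläser–Jindal, ITCS 2019, Thm. 4: the witness of a symmetric polynomial has
circuits of size polynomial in the circuit size and degree of the symmetric polynomial and the
number of variables). That fact is now a theorem of the tree
(`Literature.Computability.AlgebraicComplexity.BlaserJindal2019_thm4_holds`,
`Literature/Computability/AlgebraicComplexity/BlaserJindalSymmetricProofs.lean`: root-free slow Newton
iteration + Vieta from approximate roots + the degree lemma `deg f ≤ deg f_Sym`), so ζ-E holds
outright: `qpSymmetric_of_entrySymmetric_holds`.

This is a SUPPORT lemma for the crux `MonotoneRestorationQP` (the entry-symmetric slice of its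
conclusion); it does not close the crux, whose content is the passage from the matrix-symmetric
invariant ring (`S_n × S_n`, not a polynomial ring) to such a presentation. Honest framing: nothing
here bears on VP versus VNP, which is NOT proved.
-/

noncomputable section

-- `Summit.ValiantsHypothesis.ValiantsHypothesis.…` is the tree's mandated namespace (Sub = Summit).
set_option linter.dupNamespace false

namespace Summit.ValiantsHypothesis.ValiantsHypothesis.Theorems

open Literature.Computability.AlgebraicComplexity

/-- **THEOREM ζ-E, unconditional.** Every `VP` family `f_n ∈ ℂ[x_ij : i, j < n]` invariant under ALL
permutations of the `n²` entries has square-symmetric circuits of quasi-polynomial size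
`≤ 2^{(log₂ n + c)^c}`: the conditional `qpSymmetric_of_entrySymmetric` applied to the tree's proof
`BlaserJindal2019_thm4_holds` of Bläser–Jindal 2019, Thm. 4. [cite: BlaserJindal2019, Thm. 4] -/
theorem qpSymmetric_of_entrySymmetric_holds
    (f : (n : ℕ) → MvPolynomial (Fin n × Fin n) ℂ)
    (hsym : ∀ (n : ℕ) (π : Equiv.Perm (Fin n × Fin n)), MvPolynomial.rename π (f n) = f n)
    (hVP : IsVPFamily f) :
    ∃ c : ℕ, ∀ n : ℕ, ∃ (G : Type) (_ : Fintype G)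
      (C : LabelledArithCircuit ℂ (Fin n × Fin n) Unit G),
      C.IsSymmetric (Equiv.Perm (Fin n)) ∧ C.eval (C.output ()) = f n ∧
        Fintype.card G ≤ 2 ^ ((Nat.log 2 n + c) ^ c) :=
  qpSymmetric_of_entrySymmetric BlaserJindal2019_thm4_holds f hsym hVP

end Summit.ValiantsHypothesis.ValiantsHypothesis.Theorems

end
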